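import Summits.CriticalPhenomena.PercolationContinuityZ3.Theorems.PercNearOneGluingNoHeavyLowerTailMergeStability
import Summits.CriticalPhenomena.PercolationContinuityZ3.Theorems.PercNearOneGluingAdditiveGluingTieLiftOne
import Summits.CriticalPhenomena.PercolationContinuityZ3.Theorems.PercNearOneGluingAdditiveGluingGlueReach
import HarnessLib

/-!
# `NoHeavyLowerTail` (stmt-CriticalPhenomena-4575) — CHAMPION STABILITY FOR VERTEX PAIRS (CS₂) implies merge
# stability, hence the cumulative isolation lemma and the crux

Seat `prim-gen-swap` (route-task gen-swap), 2026-08-18.  `μ = prodBernoulli w` on `Fin n`, relays `A`, level `j`,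
`π(z) = {a ∈ A : z ↔ a}`, `R_a = {|π(a)| ≤ j}`, champion `c ∈ argmax_a μ(R_a)` (a function of the relay geometry only —
no observer enters `R_a`).

**CS₂ (registered stub `stub_championStabilityPair`; observer-free, gluing-free form of merge stability).**  For any two
vertices `x ∉ A` and `y` and a champion `c`:

  `μ(c ↮ x, c ↮ y, 1 ≤ |π(x) ∪ π(y)| ≤ j) ≤ μ(c ↮ x, c ↮ y, |π(c)| ≤ j)`.

For `x = y` this is exactly CIL in its off-diagonal form (`μ(L) ≤ μ(R_c)` minus the common part `{c ↔ x}`), i.e. CS₁ = CIL;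
CS₂ says the champion of the relay geometry also serves the two-point observer `{x, y}`.

* `ChampionStability.reachable_insert_iff` — reachability after opening the pair `s(o,v)`: `x ↔' y` iff `x ↔ y` or
  (`x ↔ {o,v}` and `{o,v} ↔ y`) (from the landed gluing lemmas `glueReach_walk_split` / `glueReach_of_split`);
* `mergeStability_of_championStabilityPair` — CS₂ ⇒ `stub_mergeStability` (pull `μ_{w[s(o,v)↦1]}` back along
  `ω ↦ insert s(o,v) ω` with `tieLiftOne_real_one_eq`; on `{o ↔' c}` the two events of MS coincide, off it they are the two
  events of CS₂);
* `cumulativeIsolation_of_championStabilityPair`, `noHeavyLowerTail_of_championStabilityPair` — hence CIL (all levels)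
  and the crux, through the landed `cumulativeIsolation_of_mergeStability`.

Evidence for CS₂ (report MERGE-STABILITY.md on the item): 0 failures in ≈1.26·10⁷ exhaustive `p = ½` instances and ≈5 000 exact
weighted instances (incl. `y` a relay, all maximisers); the converse transfer and every other tested monotonicity are false;
CS₂ at level `j = 1` is proved on paper there (BHK 2006 Thm 1.3 rows + Harris).
-/

noncomputable section

namespace Summit.CriticalPhenomena.PercolationContinuityZ3.Theorems

open MeasureTheory Set Literature.Probability.LatticeModels Literature.Probability.Percolation
open scoped Classical BigOperators

variable {n : ℕ}

namespace ChampionStability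

/-- **Reachability after opening one pair.**  For `o ≠ v`: `x ↔ y` in `insert s(o,v) ω` iff `x ↔ y` in `ω`, or `x`
reaches `{o, v}` and `{o, v}` reaches `y` in `ω`. [folklore] -/
theorem reachable_insert_iff (ω : BondConfig (Fin n)) {o v : Fin n} (hov : o ≠ v) (x y : Fin n) :
    (openGraph (insert s(o, v) ω)).Reachable x y ↔
      ((openGraph ω).Reachable x y ∨
        ((∃ s ∈ ({o, v} : Finset (Fin n)), (openGraph ω).Reachable x s) ∧
          (∃ s ∈ ({o, v} : Finset (Fin n)), (openGraph ω).Reachable s y))) := by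
  have hHG : ∀ a b : Fin n, (openGraph (insert s(o, v) ω)).Adj a b →
      (openGraph ω).Adj a b ∨ (a ∈ ({o, v} : Finset (Fin n)) ∧ b ∈ ({o, v} : Finset (Fin n))) := by
    intro a b hab
    rw [openGraph_adj, Set.mem_insert_iff] at hab
    obtain ⟨h | h, hne⟩ := hab
    · right
      rw [Sym2.eq, Sym2.rel_iff'] at h
      rcases h with ⟨rfl, rfl⟩ | ⟨rfl, rfl⟩ <;> simp
    · exact Or.inl ((openGraph_adj ω a b).2 ⟨h, hne⟩)
  have hGH : openGraph ω ≤ openGraph (insert s(o, v) ω) := by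
    intro a b hab
    rw [openGraph_adj] at hab ⊢
    exact ⟨Set.mem_insert_of_mem _ hab.1, hab.2⟩
  have hSS : ∀ a b : Fin n, a ∈ ({o, v} : Finset (Fin n)) → b ∈ ({o, v} : Finset (Fin n)) → a ≠ b →
      (openGraph (insert s(o, v) ω)).Adj a b := by
    intro a b ha hb hne
    rw [openGraph_adj]
    refine ⟨?_, hne⟩
    simp only [Finset.mem_insert, Finset.mem_singleton] at ha hb
    have hab : s(a, b) = s(o, v) := by
      rcases ha with rfl | rfl <;> rcases hb with rfl | rfl
      · exact absurd rfl hne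
      · rfl
      · exact Sym2.eq_swap
      · exact absurd rfl hne
    rw [hab]
    exact Set.mem_insert _ _
  exact ⟨fun ⟨wk⟩ => glueReach_walk_split hHG wk, fun h => glueReach_of_split hGH hSS h⟩

/-- From `o` after opening `s(o,v)`: `o ↔' x` iff `o ↔ x` or `v ↔ x`. [folklore] -/
theorem reachable_insert_left_iff (ω : BondConfig (Fin n)) {o v : Fin n} (hov : o ≠ v) (x : Fin n) :
    (openGraph (insert s(o, v) ω)).Reachable o x ↔
      ((openGraph ω).Reachable o x ∨ (openGraph ω).Reachable v x) := by
  rw [reachable_insert_iff ω hov]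
  constructor
  · rintro (h | ⟨-, ⟨s, hs, hsx⟩⟩)
    · exact Or.inl h
    · simp only [Finset.mem_insert, Finset.mem_singleton] at hs
      rcases hs with rfl | rfl
      · exact Or.inl hsx
      · exact Or.inr hsx
  · rintro (h | h)
    · exact Or.inl h
    · exact Or.inr ⟨⟨o, by simp, SimpleGraph.Reachable.refl o⟩, ⟨v, by simp, h⟩⟩

/-- A vertex not joined to `o` nor to `v` keeps its cluster when `s(o,v)` is opened. [folklore] -/
theorem reachable_insert_iff_of_not (ω : BondConfig (Fin n)) {o v c : Fin n} (hov : o ≠ v)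
    (hco : ¬ (openGraph ω).Reachable c o) (hcv : ¬ (openGraph ω).Reachable c v) (x : Fin n) :
    (openGraph (insert s(o, v) ω)).Reachable c x ↔ (openGraph ω).Reachable c x := by
  rw [reachable_insert_iff ω hov]
  constructor
  · rintro (h | ⟨⟨s, hs, hcs⟩, -⟩)
    · exact h
    · simp only [Finset.mem_insert, Finset.mem_singleton] at hs
      rcases hs with rfl | rfl
      · exact absurd hcs hco
      · exact absurd hcs hcv
  · exact fun h => Or.inl h

/-- `c ↔' o` after opening `s(o,v)` iff `c ↔ o` or `c ↔ v` before. [folklore] -/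
theorem reachable_insert_to_left_iff (ω : BondConfig (Fin n)) {o v : Fin n} (hov : o ≠ v) (c : Fin n) :
    (openGraph (insert s(o, v) ω)).Reachable c o ↔
      ((openGraph ω).Reachable c o ∨ (openGraph ω).Reachable c v) := by
  rw [SimpleGraph.reachable_comm, reachable_insert_left_iff ω hov c, SimpleGraph.reachable_comm,
    @SimpleGraph.reachable_comm _ _ v c]

/-- With `w s(o,v) = 0`: `μ_{w[s(o,v)↦1]}(S) = μ_w((insert s(o,v))⁻¹' S)`. [folklore] -/
theorem real_update_one_eq (w : Sym2 (Fin n) → unitInterval) {o v : Fin n} (hw : w s(o, v) = 0)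
    (S : Set (BondConfig (Fin n))) :
    (prodBernoulli (Function.update w s(o, v) 1)).real S =
      (prodBernoulli w).real ((fun ω : BondConfig (Fin n) => insert s(o, v) ω) ⁻¹' S) := by
  rw [tieLiftOne_real_one_eq]
  have h0 : Function.update w s(o, v) 0 = w := by
    rw [Function.update_eq_self_iff]; exact hw.symm
  rw [h0]

end ChampionStability

open ChampionStability in
/-- **CS₂ ⇒ merge stability.**  Champion stability for vertex pairs (`stub_championStabilityPair`) implies the
registered `stub_mergeStability` verbatim. -/
theorem mergeStability_of_championStabilityPair
    (hCS : ∀ (n : ℕ) (w : Sym2 (Fin n) → unitInterval) (A : Finset (Fin n)) (x y c : Fin n) (j : ℕ),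
      x ∉ A → c ∈ A →
      (∀ a ∈ A,
        (Literature.Probability.LatticeModels.prodBernoulli w).real
            {ω : Literature.Probability.Percolation.BondConfig (Fin n) |
              (A.filter fun z => ω ∈ Literature.Probability.Percolation.openConn a z).card ≤ j} ≤
          (Literature.Probability.LatticeModels.prodBernoulli w).real
            {ω : Literature.Probability.Percolation.BondConfig (Fin n) |
              (A.filter fun z => ω ∈ Literature.Probability.Percolation.openConn c z).card ≤ j}) →
      (Literature.Probability.LatticeModels.prodBernoulli w).real
          {ω : Literature.Probability.Percolation.BondConfig (Fin n) |
            ω ∉ Literature.Probability.Percolation.openConn c x ∧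
            ω ∉ Literature.Probability.Percolation.openConn c y ∧
            1 ≤ (A.filter fun z => ω ∈ Literature.Probability.Percolation.openConn x z ∨
                  ω ∈ Literature.Probability.Percolation.openConn y z).card ∧
            (A.filter fun z => ω ∈ Literature.Probability.Percolation.openConn x z ∨
                  ω ∈ Literature.Probability.Percolation.openConn y z).card ≤ j} ≤
        (Literature.Probability.LatticeModels.prodBernoulli w).real
          {ω : Literature.Probability.Percolation.BondConfig (Fin n) |
            ω ∉ Literature.Probability.Percolation.openConn c x ∧
            ω ∉ Literature.Probability.Percolation.openConn c y ∧
            (A.filter fun z => ω ∈ Literature.Probability.Percolation.openConn c z).card ≤ j}) :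
    ∀ (n : ℕ) (w : Sym2 (Fin n) → unitInterval) (A : Finset (Fin n)) (o v aStar : Fin n) (j : ℕ),
      o ∉ A → v ≠ o → aStar ∈ A → w s(o, v) = 0 →
      (∀ a ∈ A,
        (Literature.Probability.LatticeModels.prodBernoulli w).real
            {ω : Literature.Probability.Percolation.BondConfig (Fin n) |
              (A.filter fun x => ω ∈ Literature.Probability.Percolation.openConn a x).card ≤ j} ≤
          (Literature.Probability.LatticeModels.prodBernoulli w).real
            {ω : Literature.Probability.Percolation.BondConfig (Fin n) |
              (A.filter fun x => ω ∈ Literature.Probability.Percolation.openConn aStar x).card ≤ j}) →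
      (Literature.Probability.LatticeModels.prodBernoulli (Function.update w s(o, v) 1)).real
          {ω : Literature.Probability.Percolation.BondConfig (Fin n) |
            1 ≤ (A.filter fun x => ω ∈ Literature.Probability.Percolation.openConn o x).card ∧
              (A.filter fun x => ω ∈ Literature.Probability.Percolation.openConn o x).card ≤ j} ≤
        (Literature.Probability.LatticeModels.prodBernoulli (Function.update w s(o, v) 1)).real
          {ω : Literature.Probability.Percolation.BondConfig (Fin n) |
            (A.filter fun x => ω ∈ Literature.Probability.Percolation.openConn aStar x).card ≤ j} := by
  intro n w A o v c j ho hvo hc hw hchamp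
  have hov : o ≠ v := fun h => hvo h.symm
  set μ₁ := prodBernoulli (Function.update w s(o, v) 1) with hμ₁
  set L₁ : Set (BondConfig (Fin n)) := {ω | 1 ≤ (A.filter fun x => ω ∈ openConn o x).card ∧
      (A.filter fun x => ω ∈ openConn o x).card ≤ j} with hL₁
  set R₁ : Set (BondConfig (Fin n)) := {ω | (A.filter fun x => ω ∈ openConn c x).card ≤ j} with hR₁
  set C : Set (BondConfig (Fin n)) := openConn o c with hC
  -- split both events along `C = {o ↔ c}`
  have hsplit : ∀ S : Set (BondConfig (Fin n)), μ₁.real S = μ₁.real (S ∩ C) + μ₁.real (S \ C) :=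
    fun S => (measureReal_inter_add_sdiff (μ := μ₁) (s := S) (Set.toFinite C).measurableSet).symm
  -- on `C` the two events coincide
  have hLC : L₁ ∩ C = R₁ ∩ C := by
    ext ω
    simp only [hL₁, hR₁, hC, mem_inter_iff, mem_setOf_eq]
    constructor
    · rintro ⟨⟨-, h2⟩, hoc⟩
      have hoc' : (openGraph ω).Reachable o c := hoc
      have heq : (A.filter fun x => ω ∈ openConn c x) = (A.filter fun x => ω ∈ openConn o x) := by
        refine Finset.filter_congr fun x _ => ⟨fun h => ?_, fun h => ?_⟩
        · exact hoc'.trans h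
        · exact hoc'.symm.trans h
      rw [heq]
      exact ⟨h2, hoc⟩
    · rintro ⟨h2, hoc⟩
      have hoc' : (openGraph ω).Reachable o c := hoc
      have heq : (A.filter fun x => ω ∈ openConn o x) = (A.filter fun x => ω ∈ openConn c x) := by
        refine Finset.filter_congr fun x _ => ⟨fun h => ?_, fun h => ?_⟩
        · exact hoc'.symm.trans h
        · exact hoc'.trans h
      rw [heq]
      refine ⟨⟨Finset.card_pos.2 ⟨c, Finset.mem_filter.2 ⟨hc, ?_⟩⟩, h2⟩, hoc⟩
      exact SimpleGraph.Reachable.refl c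
  -- off `C`, pull back to `μ_w` and identify with the two events of CS₂
  have hLoff : μ₁.real (L₁ \ C) = (prodBernoulli w).real {ω : BondConfig (Fin n) |
      ω ∉ openConn c o ∧ ω ∉ openConn c v ∧
      1 ≤ (A.filter fun z => ω ∈ openConn o z ∨ ω ∈ openConn v z).card ∧
      (A.filter fun z => ω ∈ openConn o z ∨ ω ∈ openConn v z).card ≤ j} := by
    rw [hμ₁, real_update_one_eq w hw]
    congr 1
    ext ω
    simp only [hL₁, hC, mem_preimage, mem_sdiff, mem_setOf_eq]
    have hfilt : (A.filter fun x => insert s(o, v) ω ∈ openConn o x) =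
        (A.filter fun z => ω ∈ openConn o z ∨ ω ∈ openConn v z) := by
      refine Finset.filter_congr fun x _ => ?_
      exact reachable_insert_left_iff ω hov x
    have hco : insert s(o, v) ω ∈ openConn o c ↔ (ω ∈ openConn c o ∨ ω ∈ openConn c v) := by
      show (openGraph (insert s(o, v) ω)).Reachable o c ↔
        ((openGraph ω).Reachable c o ∨ (openGraph ω).Reachable c v)
      rw [SimpleGraph.reachable_comm]
      exact reachable_insert_to_left_iff ω hov c
    rw [hfilt, hco]
    tauto
  have hRoff : μ₁.real (R₁ \ C) = (prodBernoulli w).real {ω : BondConfig (Fin n) |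
      ω ∉ openConn c o ∧ ω ∉ openConn c v ∧ (A.filter fun z => ω ∈ openConn c z).card ≤ j} := by
    rw [hμ₁, real_update_one_eq w hw]
    congr 1
    ext ω
    simp only [hR₁, hC, mem_preimage, mem_sdiff, mem_setOf_eq]
    have hco : insert s(o, v) ω ∈ openConn o c ↔ (ω ∈ openConn c o ∨ ω ∈ openConn c v) := by
      show (openGraph (insert s(o, v) ω)).Reachable o c ↔
        ((openGraph ω).Reachable c o ∨ (openGraph ω).Reachable c v)
      rw [SimpleGraph.reachable_comm]
      exact reachable_insert_to_left_iff ω hov c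
    rw [hco]
    constructor
    · rintro ⟨hcard, hnot⟩
      have hco' : ¬ (openGraph ω).Reachable c o := fun h => hnot (Or.inl h)
      have hcv' : ¬ (openGraph ω).Reachable c v := fun h => hnot (Or.inr h)
      have hfilt : (A.filter fun x => insert s(o, v) ω ∈ openConn c x) =
          (A.filter fun z => ω ∈ openConn c z) := by
        refine Finset.filter_congr fun x _ => ?_
        exact reachable_insert_iff_of_not ω hov hco' hcv' x
      rw [hfilt] at hcard
      exact ⟨hco', hcv', hcard⟩
    · rintro ⟨hco', hcv', hcard⟩
      have hfilt : (A.filter fun x => insert s(o, v) ω ∈ openConn c x) =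
          (A.filter fun z => ω ∈ openConn c z) := by
        refine Finset.filter_congr fun x _ => ?_
        exact reachable_insert_iff_of_not ω hov hco' hcv' x
      rw [hfilt]
      exact ⟨hcard, fun h => h.elim hco' hcv'⟩
  have key := hCS n w A o v c j ho hc hchamp
  rw [hsplit L₁, hsplit R₁, hLC, hLoff, hRoff]
  linarith

/-- **CS₂ ⇒ CIL (all levels)**, through `cumulativeIsolation_of_mergeStability`. -/
theorem cumulativeIsolation_of_championStabilityPair
    (hCS : ∀ (n : ℕ) (w : Sym2 (Fin n) → unitInterval) (A : Finset (Fin n)) (x y c : Fin n) (j : ℕ),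
      x ∉ A → c ∈ A →
      (∀ a ∈ A,
        (Literature.Probability.LatticeModels.prodBernoulli w).real
            {ω : Literature.Probability.Percolation.BondConfig (Fin n) |
              (A.filter fun z => ω ∈ Literature.Probability.Percolation.openConn a z).card ≤ j} ≤
          (Literature.Probability.LatticeModels.prodBernoulli w).real
            {ω : Literature.Probability.Percolation.BondConfig (Fin n) |
              (A.filter fun z => ω ∈ Literature.Probability.Percolation.openConn c z).card ≤ j}) →
      (Literature.Probability.LatticeModels.prodBernoulli w).real
          {ω : Literature.Probability.Percolation.BondConfig (Fin n) |
            ω ∉ Literature.Probability.Percolation.openConn c x ∧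
            ω ∉ Literature.Probability.Percolation.openConn c y ∧
            1 ≤ (A.filter fun z => ω ∈ Literature.Probability.Percolation.openConn x z ∨
                  ω ∈ Literature.Probability.Percolation.openConn y z).card ∧
            (A.filter fun z => ω ∈ Literature.Probability.Percolation.openConn x z ∨
                  ω ∈ Literature.Probability.Percolation.openConn y z).card ≤ j} ≤
        (Literature.Probability.LatticeModels.prodBernoulli w).real
          {ω : Literature.Probability.Percolation.BondConfig (Fin n) |
            ω ∉ Literature.Probability.Percolation.openConn c x ∧
            ω ∉ Literature.Probability.Percolation.openConn c y ∧
            (A.filter fun z => ω ∈ Literature.Probability.Percolation.openConn c z).card ≤ j}) :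
    ∀ (n : ℕ) (w : Sym2 (Fin n) → unitInterval) (A : Finset (Fin n)) (o : Fin n) (j : ℕ),
      A.Nonempty → o ∉ A → ∃ a ∈ A,
        (Literature.Probability.LatticeModels.prodBernoulli w).real
            {ω : Literature.Probability.Percolation.BondConfig (Fin n) |
              1 ≤ (A.filter fun x => ω ∈ Literature.Probability.Percolation.openConn o x).card ∧
                (A.filter fun x => ω ∈ Literature.Probability.Percolation.openConn o x).card ≤ j} ≤
          (Literature.Probability.LatticeModels.prodBernoulli w).real
            {ω : Literature.Probability.Percolation.BondConfig (Fin n) |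
              (A.filter fun x => ω ∈ Literature.Probability.Percolation.openConn a x).card ≤ j} :=
  cumulativeIsolation_of_mergeStability (mergeStability_of_championStabilityPair hCS)

/-- **CS₂ closes the crux**: `stub_championStabilityPair → NoHeavyLowerTail`. -/
theorem noHeavyLowerTail_of_championStabilityPair
    (hCS : ∀ (n : ℕ) (w : Sym2 (Fin n) → unitInterval) (A : Finset (Fin n)) (x y c : Fin n) (j : ℕ),
      x ∉ A → c ∈ A →
      (∀ a ∈ A,
        (Literature.Probability.LatticeModels.prodBernoulli w).real
            {ω : Literature.Probability.Percolation.BondConfig (Fin n) |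
              (A.filter fun z => ω ∈ Literature.Probability.Percolation.openConn a z).card ≤ j} ≤
          (Literature.Probability.LatticeModels.prodBernoulli w).real
            {ω : Literature.Probability.Percolation.BondConfig (Fin n) |
              (A.filter fun z => ω ∈ Literature.Probability.Percolation.openConn c z).card ≤ j}) →
      (Literature.Probability.LatticeModels.prodBernoulli w).real
          {ω : Literature.Probability.Percolation.BondConfig (Fin n) |
            ω ∉ Literature.Probability.Percolation.openConn c x ∧
            ω ∉ Literature.Probability.Percolation.openConn c y ∧
            1 ≤ (A.filter fun z => ω ∈ Literature.Probability.Percolation.openConn x z ∨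
                  ω ∈ Literature.Probability.Percolation.openConn y z).card ∧
            (A.filter fun z => ω ∈ Literature.Probability.Percolation.openConn x z ∨
                  ω ∈ Literature.Probability.Percolation.openConn y z).card ≤ j} ≤
        (Literature.Probability.LatticeModels.prodBernoulli w).real
          {ω : Literature.Probability.Percolation.BondConfig (Fin n) |
            ω ∉ Literature.Probability.Percolation.openConn c x ∧
            ω ∉ Literature.Probability.Percolation.openConn c y ∧
            (A.filter fun z => ω ∈ Literature.Probability.Percolation.openConn c z).card ≤ j}) :
    Summit.CriticalPhenomena.PercolationContinuityZ3.Theses.PercNearOneGluing.NoHeavyLowerTail :=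
  noHeavyLowerTail_of_mergeStability (mergeStability_of_championStabilityPair hCS)

end Summit.CriticalPhenomena.PercolationContinuityZ3.Theorems

end
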